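import Mathlib.Tactic.Linarith
import Mathlib.Tactic.NormNum
import Mathlib.Tactic.Ring
import Mathlib.Tactic.IntervalCases
import Mathlib.Data.Nat.Choose.Basic
import Mathlib.RingTheory.SimpleModule.Basic
import HarnessLib

/-!
# The (0,1) cell of the ι-window, XXVI: the product ground `B₁ × B₂`, XIII — KL rank 2 on the DEGENERATE supports: the
# monodromy-good/type-stratum principle, the chain-point lemma, tangent and trope axes (report [XXVI]): arithmetic and
# linear-algebra shadows

Family `hodge`, b2b cell `hweil` (helper of item stmt-HodgeConjecture-2524). Companion (`pg13_*`) of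
`WeilTypeLadderH2ProductGroundTwelve{,B,C,D}.lean` (pv1-g37). Report
`run/shared/lean/b2b/hodge-weil/b2b-hweil-pv1-g38/H2-ZERO-ONE-26.md` ([XXVI]). HONEST FRAMING: census results inside the ladder's
H2 test ((0,1) cell) on the SPECIAL fourfold `X₀ = B₁ × B₂`; nothing here is a rung; no case of the Hodge conjecture is proved; no
statement of [Markman 2025] / [Perry 2026] / [EdGFS 2025] is used. Conventions as in the companions: a class on `X₀` is a `3 × 3`
integer matrix in the basis `(1,θ₁,pt₁) ⊗ (1,θ₂,pt₂)`; reading W of the H2 class is `[[0,2,2],[2,2,0],[2,0,−2]]`; `B̃ᵢ` is the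
Kummer-pencil surface blown up in EIGHT (−1)-classes grouped in four ι-pairs (for a tangent axis two of the pairs are the
infinitely-near classes `ε₁, ε₂` of the doubled base pair `±z`); the hull's pair values on side 1 are `(x₃, x₄, α₁, α₂)`, on side 2
`y₁…y₄`; the chain point `(z,q)` of `Σ_A` has local model `x y = z t²` with exceptional chain `C′ ∪ C″`, `d′ = α₂ − α₁`,
`d″ = −α₂ − h_q`.
-/

-- mandated namespace `Summit.HodgeConjecture.HodgeConjecture.…` (Problem = Summit) trips `linter.dupNamespace`; the lakefile disables it
-- tree-wide (weak option), restated here so stand-alone elaboration is warning-free too.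
set_option linter.dupNamespace false

namespace Summit.HodgeConjecture.HodgeConjecture.WeilTypeLadder

section ProductGroundThirteen

/-- **LEMMA FZ, case (d1) ([XXVI] 2.3): an equivariant map into an irreducible monodromy module whose image lies in a proper
invariant submodule is zero.** Here `N` is `H₁(D̄_t, ℚ)` as a module over the group ring of `π₁(U′)` (irreducible by LEMMA MONO for
the monodromy-good pencil `ℓ₂`), `P = ker(T_{c′} − 1)` for an UNMATCHED critical value `c′` of `ℓ₂`, and `f = ψ_*`.
[`IsSimpleOrder` on the submodule lattice] -/
theorem pg13_fz_range_in_proper {R : Type*} [Ring R] {M N : Type*} [AddCommGroup M] [Module R M] [AddCommGroup N] [Module R N]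
    [IsSimpleModule R N] (f : M →ₗ[R] N) (P : Submodule R N) (hP : P ≠ ⊤) (hf : LinearMap.range f ≤ P) : f = 0 := by
  have hbot : P = ⊥ := by
    rcases IsSimpleOrder.eq_bot_or_eq_top P with h | h
    · exact h
    · exact absurd h hP
  rw [hbot, le_bot_iff, LinearMap.range_eq_bot] at hf
  exact hf

/-- **LEMMA FZ, case (d2) ([XXVI] 2.3): when every critical value of the monodromy-good pencil is matched, a non-zero equivariant
`ψ_* : H₁(Ē_t) → H₁(D̄_t)` is SURJECTIVE** (the target is irreducible), hence `ψ_t` is an isogeny as soon as the dimensions agree —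
which feeds the moduli/countability contradiction of 2.3 (d2). This is Mathlib's Schur half `LinearMap.surjective_or_eq_zero`;
only the TARGET needs to be irreducible, so the other pencil `ℓ₁` may be arbitrarily degenerate. -/
theorem pg13_fz_surjective_or_zero {R : Type*} [Ring R] {M N : Type*} [AddCommGroup M] [Module R M] [AddCommGroup N] [Module R N]
    [IsSimpleModule R N] (f : M →ₗ[R] N) : Function.Surjective f ∨ f = 0 :=
  f.surjective_or_eq_zero

/-- **LEMMA FZ (d2), the dimension bookkeeping ([XXVI] 2.3):** `rk H₁(Ē_t) = rk H₁(D̄_t) = 2·3 = 6`, so a surjective `ψ_t` between the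
3-dimensional Jacobians is an isogeny; the isogeny incidence `I_d ⊂ ℛ₃ × ℛ₃` has dimension `≤ dim M₃ = 3·3 − 3 = 6 = dim(𝒜₂ × 𝒜₂) = 3 + 3`,
so its positive-dimensional fibres lie over a locus of dimension `≤ 6 − 1 = 5 < 6`; a node pencil (s2) has normalised quotient of genus
`2 < 3`, rank `4 < 6` (then `ψ_* = 0` outright). [`norm_num`] -/
theorem pg13_fz_dims :
    (2 * 3 = (6:ℕ)) ∧ (3 * 3 - 3 = (6:ℕ)) ∧ (3 + 3 = (6:ℕ)) ∧ (6 - 1 = (5:ℕ)) ∧ (5 < (6:ℕ)) ∧ (2 * 2 = (4:ℕ)) ∧ (4 < (6:ℕ)) ∧ (2 < (3:ℕ)) := by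
  norm_num

/-- **LEMMA TS / THEOREM R2♮ ([XXVI] 3.2–3.4): the void inequality over type strata.** A row using `U` conditions transports over a
stratum of dimension `≥ t₁ + t₂ + 3 − |U|` (`tᵢ` = dimension of the type stratum of the pencil `ℓᵢ`, `3 = dim PGL₂`); with `|U| ≤ 5`
(LEMMA USE) the counting principle gives `e₁^ι ≥ 2` as soon as `t₁ + t₂ ≥ 4` — automatic when one pencil is non-degenerate (`t = 4`),
and true for the pairs (tangent, tangent) `3+3`, (tangent, trope) `3+2`, (trope, trope) / (bitangent, trope) `2+2`. Off the diagonal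
rows `|U| ≤ 4` and `t₁ + t₂ ≥ 3` suffices. [`omega`] -/
theorem pg13_type_strata_void :
    (∀ t1 t2 U : ℕ, 4 ≤ t1 + t2 → U ≤ 5 → 2 ≤ t1 + t2 + 3 - U) ∧ (∀ t1 t2 U : ℕ, 3 ≤ t1 + t2 → U ≤ 4 → 2 ≤ t1 + t2 + 3 - U) ∧
    (∀ t1 : ℕ, 4 ≤ t1 + 4) ∧ (4 ≤ 3 + 3 ∧ 4 ≤ 3 + 2 ∧ 4 ≤ 2 + 2) ∧ (3 + 4 + 3 - 5 = (5:ℕ)) ∧ (2 + 4 + 3 - 5 = (4:ℕ)) := by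
  refine ⟨?_, ?_, ?_, by norm_num, by norm_num, by norm_num⟩
  · intro t1 t2 U h hU; omega
  · intro t1 t2 U h hU; omega
  · intro t1; omega

/-- **PROPOSITION TAN / TROPE, the Euler bookkeeping ([XXVI] 5.1, 6.1, 7.1):** on the eightfold blow-up `B̃₁` (`e(B̃₁) = 8`, general
fibre of genus 5, `e = −8`) the singular fibres account for `e(B̃₁) − 2·(−8) = 24`: non-degenerate `16·1 + 4·2`; tangent axis (s3)
`16·1 + 2·2 + 4` (the T-fibre is a 4-cycle of two genus-2 curves and two (−2)-curves: `χ = −2 −2 + 2 + 2 − 4 = −4`, `e = −4 + 8`);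
trope axis (s4) `10·1 + 2·2 + 10` (`16 − 6 = 10` nodes off the trope plane; the trope fibre `2Θ̃_κ + Σ₄ e′` has `χ_red = −2 + 4·2 − 4 = 2`,
`e = 2 + 8`); (s5b) `15·1 + 3·2 + 3` (the reducible tacnodal member `Θ_y ∪ Θ_{−y} ∋ w`: `χ = −2 −2 −1`, `e = −5 + 8`); node axis (s2) on
the fivefold blow-up (`e = 5`, fibre genus 4): `5 − 2·(−6) = 17 = 15 + 2`. [`norm_num`] -/
theorem pg13_euler_bookkeeping :
    (8 - 2 * (-8) = (24:ℤ)) ∧ (16 * 1 + 4 * 2 = (24:ℤ)) ∧ (16 * 1 + 2 * 2 + 4 = (24:ℤ)) ∧ (-2 - 2 + 2 + 2 - 4 = (-4:ℤ)) ∧ (-4 + 8 = (4:ℤ)) ∧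
    (16 - 6 = (10:ℤ)) ∧ (10 * 1 + 2 * 2 + 10 = (24:ℤ)) ∧ (-2 + 4 * 2 - 4 = (2:ℤ)) ∧ (2 + 8 = (10:ℤ)) ∧
    (15 * 1 + 3 * 2 + 3 = (24:ℤ)) ∧ (-2 - 2 - 1 + 8 = (3:ℤ)) ∧ (5 - 2 * (-6) = (17:ℤ)) ∧ (15 + 2 = (17:ℤ)) := by
  norm_num

/-- **PROPOSITION TAN, the intersection numbers on `B̃₁` ([XXVI] 5.1):** with `θ² = 2`, eight orthonormal (−1)-classes and
`f₁ = 2θ − Σ₈`: `f₁² = 4·2 − 8 = 0`; the (−2)-curve `e′ = ε₁ − ε₂` has `e′² = −1 −1 = −2`, `e′·e″ = 0 − (−1) = 1`, `f₁·e′ = −(−1) + (−1) = 0`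
(a fibre component) and `f₁·e″ = −(−1) = 1` (a section); a theta component through four of the eight classes has `Θ̃² = 2 − 4 = −2`
and `f₁·Θ̃ = 2·2 − 4 = 0`; `Θ̃_κ·e′ = −(ε₁·ε₁) = 1`; the trope fibre `(2Θ̃_κ + Σ₄e′)² = 4(−2) + 4(−2) + 2·2·4 = 0`. [`norm_num`] -/
theorem pg13_tangent_surface_numerics :
    (4 * 2 - 8 = (0:ℤ)) ∧ (-1 - 1 = (-2:ℤ)) ∧ (0 - (-1) = (1:ℤ)) ∧ (-(-1) + (-1) = (0:ℤ)) ∧ (-(-1:ℤ) = 1) ∧ (2 - 4 = (-2:ℤ)) ∧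
    (2 * 2 - 4 = (0:ℤ)) ∧ (4 * (-2) + 4 * (-2) + 2 * 2 * 4 = (0:ℤ)) := by
  norm_num

/-- **LEMMA CH / CS2♯ ([XXVI] 4.3, 5.4): admissibility is automatic in the Cauchy–Schwarz patterns.** In a pattern `(k,k,k,k±1)` any two
entries differ by at most one, so whichever two of the four side-1 pair values are the infinitely-near pair `(α₁, α₂)`, the lift degree
`d′ = α₂ − α₁` lies in `{−1, 0, 1}` — the admissible range of LEMMA CH (finite `R¹π_*`, reflexive `π_*`). [`omega`] -/
theorem pg13_admissible_in_pattern : ∀ k a1 a2 : ℤ,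
    (a1 = k ∨ a1 = k + 1) → (a2 = k ∨ a2 = k + 1) → (-1 ≤ a2 - a1 ∧ a2 - a1 ≤ 1) := by
  intro k a1 a2 h1 h2; omega

/-- **LEMMA CH ([XXVI] 4.3): the chain-point degrees of the H2 hulls.** In the normalisation `a₁ = 1` (side-1 special value `1`, others
`0`; side-2 values `h_q ∈ {0, −1}`) with the `d′ ∈ {0,1}`-lift for the even/odd hulls and the `d′ = −1` lift listed for completeness:
every chain point has `(d′, d″) = (α₂ − α₁, −α₂ − h_q)` in the set where the toric table gives `λ = 0` — namely `d′ ∈ {0,1}` with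
`d″ ≥ −1`, or `d′ = −1` with `d″ ≥ 0`; the one dangerous combination `(d′,d″) = (−1,−1)` (λ = 1) never occurs. [`decide` on the six cases] -/
theorem pg13_chain_degrees_in_pattern : ∀ a1 a2 h : ℤ,
    ((a1 = 0 ∧ a2 = 0) ∨ (a1 = 0 ∧ a2 = 1) ∨ (a1 = 1 ∧ a2 = 0)) → (h = 0 ∨ h = -1) →
    (((a2 - a1 = 0 ∨ a2 - a1 = 1) ∧ -1 ≤ -a2 - h) ∨ (a2 - a1 = -1 ∧ 0 ≤ -a2 - h)) := by
  intro a1 a2 h hα hh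
  rcases hα with ⟨rfl, rfl⟩ | ⟨rfl, rfl⟩ | ⟨rfl, rfl⟩ <;> rcases hh with rfl | rfl <;> norm_num

/-- **LEMMA CH, the closed forms ([XXVI] 4.2; `chain_toric.out`):** the χ-correction at a chain point is `λ(0,d″) = 2·C(1−d″,3)` and
`λ(1,d″) = C(1−d″,3) + C(−d″,3)` for `d″ ≤ −2` (and `0` for `d″ ≥ −1`): the table values `2, 8, 20, 40` and `1, 5, 14, 30` at
`d″ = −2, −3, −4, −5`, against the threefold-node values `C(1−k,3) = 1, 4, 10, 20` (LEMMA ODP). [`decide`] -/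
theorem pg13_chain_closed_forms :
    (2 * Nat.choose 3 3 = 2 ∧ 2 * Nat.choose 4 3 = 8 ∧ 2 * Nat.choose 5 3 = 20 ∧ 2 * Nat.choose 6 3 = 40) ∧
    (Nat.choose 3 3 + Nat.choose 2 3 = 1 ∧ Nat.choose 4 3 + Nat.choose 3 3 = 5 ∧ Nat.choose 5 3 + Nat.choose 4 3 = 14 ∧
      Nat.choose 6 3 + Nat.choose 5 3 = 30) ∧
    (Nat.choose 3 3 = 1 ∧ Nat.choose 4 3 = 4 ∧ Nat.choose 5 3 = 10 ∧ Nat.choose 6 3 = 20) := by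
  decide

/-- **REMARK ODP⁺ ([XXVI] 4.4): the node correction is ONE-SIDED.** The length of `R¹` of the small contraction at a threefold node for a
hull of degree `k = −v − h` on the exceptional curve is `C(1−k, 3)` for `k ≤ −2` and ZERO for `k ≥ −1` (Hartogs: `π_*` is always the
hull). The integer polynomial `n(n−1)(n−2)/6` at `n = v + h + 1 ≤ −1` is NEGATIVE (`−1, −4, −10` at `n = −1, −2, −3`), so the signed
polynomial is the correction only in the range `v + h ≥ −1` — which contains every range the lineage used (`v + h ∈ {−1,0,1}` in CS2,
`v + h − δ ≥ −1` in PROPOSITION TT, whose script guards `comb(n,3) if n ≥ 3`). [`norm_num`] -/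
theorem pg13_odp_one_sided :
    ((-1:ℤ) * (-2) * (-3) / 6 = -1) ∧ ((-2:ℤ) * (-3) * (-4) / 6 = -4) ∧ ((-3:ℤ) * (-4) * (-5) / 6 = -10) ∧
    (∀ v h : ℤ, (v = 0 ∨ v = 1) → (h = 0 ∨ h = -1) → -1 ≤ v + h ∧ v + h ≤ 1) := by
  refine ⟨by norm_num, by norm_num, by norm_num, ?_⟩
  intro v h hv hh; omega

/-- **PROPOSITION TAN, the degrees and the colength table♯ ([XXVI] 5.6–5.7).** Degrees of the `d′ ∈ {0,1}`-lift: on the T-member's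
component `Θ̃_x` (through `±z` to first order and one point of each simple pair) `2a₁ + 2α₁ + x₃ + x₄ = 2 + 0 + x₃ + x₄`, i.e. `3`
(even hulls, `x₃ + x₄ = 1`, `χ = 3 + 1 − 2 = 2`) or `2` (odd hull, `χ = 1`); on a vertical theta translate in `V_z`: `2a₂ − 4α₂ = 4`
(`χ` of the pair `6`) or `0` (`χ = −2`). New rows: P7 `(α, β′_T)` odd: `c₀ = 4 − 2 − 2 = 0`; P8 `(γ_z, β′_T)` odd: `4 + 2 − 2 = 4`;
P4_T `(γ_p, β′_T)` even: `4 + 2 − 4 = 2`; EXAMPLE check `ch₄`: `2 − 2 − (1 + 1) = −2`. TROPE: `Θ̃_κ`-degree `2 + 0 = 2`, `χ = 1`,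
rows P1_κ `4 − 2 − 2 = 0`, P5_κ `4 + 2 − 2 = 4`. [`norm_num`] -/
theorem pg13_tangent_colengths :
    (2 * 1 + 2 * 0 + 1 = (3:ℤ)) ∧ (3 + 1 - 2 = (2:ℤ)) ∧ (2 * 1 + 2 * 0 + 0 = (2:ℤ)) ∧ (2 + 1 - 2 = (1:ℤ)) ∧
    (2 * 2 - 4 * 0 = (4:ℤ)) ∧ (2 * (4 + 1 - 2) = (6:ℤ)) ∧ (2 * 2 - 4 * 1 = (0:ℤ)) ∧ (2 * (0 + 1 - 2) = (-2:ℤ)) ∧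
    (4 - 2 - 2 = (0:ℤ)) ∧ (4 - (-2) - 2 = (4:ℤ)) ∧ (4 - (-2) - 4 = (2:ℤ)) ∧ (2 - 2 - (1 + 1) = (-2:ℤ)) ∧
    (2 + 0 = (2:ℤ)) ∧ (4 - 2 - (1 + 1) = (0:ℤ)) ∧ (4 - (-2) - (1 + 1) = (4:ℤ)) := by
  norm_num

/-- **PROPOSITION TROPE / the type dimensions ([XXVI] 3.1, 6.1, 7.3):** the type strata in `Gr(2,4)` (dimension `4`): tangent axes
`2 + 1 = 3`, axes in a trope plane `2`, bitangent axes `2`, axes meeting a node-line (s5a) `3`, (s5b) `3`, node axes `2`; the trope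
plane carries `6` nodes and `16 − 6 = 10` lie off it, so a trope-axis pencil has `1 + 10 + 2 = 13` critical values, a tangent one
`1 + 2 + 16 = 19`, an (s5b) one `15 + 1 + 3 = 19`, a node one `15 + 2 = 17`; only a pencil with `20` distinct critical values can absorb
all twenty of a non-degenerate partner (total matching), and `19 < 20`, `17 < 20`, `13 < 20`. [`norm_num`] -/
theorem pg13_type_dimensions :
    (2 + 1 = (3:ℕ)) ∧ (16 - 6 = (10:ℕ)) ∧ (1 + 10 + 2 = (13:ℕ)) ∧ (1 + 2 + 16 = (19:ℕ)) ∧ (15 + 1 + 3 = (19:ℕ)) ∧ (15 + 2 = (17:ℕ)) ∧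
    (19 < (20:ℕ)) ∧ (17 < (20:ℕ)) ∧ (13 < (20:ℕ)) := by
  norm_num

end ProductGroundThirteen

end Summit.HodgeConjecture.HodgeConjecture.WeilTypeLadder
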